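import Summits.QuantumFields.BalabanUV.Beta.ResolventBoxCertificate

/-!
# Beta / CoverSchedules — COVERAGE IN THE KERNEL: box schedules as a kernel inductive; the coverage binders `hcov` (quarter region of the
# vertex tori) and `hcovF` (fin rectangles) of row CAP-k's typed target AS THEOREMS for the leaf list of ANY schedule
# (β sub-cell, BINDER-OWNERS row CAP-k, lineage `b2b-balaban-beta-an5`, gen 26; node BETA-an5-g26-SCHEDULES, leaf 1; journal CLAIM l.17735)

The typed target `CapRouteAFins.rowsOfOneLoopFormCode16E_routeA₂_ofBoxesRealShift_ofReflect_ofFinRects` (p225736) carries, next to the per-leaf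
certificates `hcert` ∕ `hcertF`, two purely COMBINATORIAL binders about the engines' box lists:

* `hcov  : ∀ q ∈ VertexTori κ, Im q_{ν₀} = κ → Re q_{ν₁} ≤ 0 → ∃ bx ∈ boxes, q ∈ Box (ctr bx) (hw bx)` — the boxes cover the quarter region;
* `hcovF : ∀ i, ∀ τ ∈ [0,1], ∀ x ∈ [−π,π], ∃ bx ∈ rects i, |τ − τc i bx| ≤ hτ i bx ∧ |x − xc i bx| ≤ hx i bx` — the rectangles cover the fin.

For an OPAQUE list of ≈ 10⁵ engine boxes these are external facts to be re-checked; for a KERNEL-DEFINED SCHEDULE they are theorems.  This module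
defines schedules and proves the two binders once and for all:

* §1 real boxes `RBox c h = {x | |x_μ − c_μ| ≤ h_μ}`, the uniform sub-grid of a box with `m_μ + 1` cells along coordinate `μ` (`subCtr`, `subHw`),
  the one floor-lemma `exists_fin_abs_sub_le`, `exists_mem_subBox` (the sub-grid covers the box), `subBox_subset` (sub-cells lie in the box);
* §2 **`Sched d`** — a schedule is a `leaf` (certify this box) or a `split m child` (cut the box into the uniform `Π_μ (m_μ + 1)` sub-grid and run
  the schedule `child j` on cell `j`): every adaptive m-adic ∕ dyadic refinement tree of any depth profile, per-coordinate anisotropic, is an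
  instance (`Sched.uniform`, `Sched.bisect`, `Sched.refine`); `Sched.leaves c h` = the finite list of leaf boxes; **`Sched.cover`**: the leaves of ANY
  schedule cover its root box (structural induction); `Sched.leaves_subset`: every leaf lies inside the root;
* §3 complex boxes over real leaves on a sign-class torus `Im q = σ` (`cbox`, `mem_box_cbox`) — literally `ResolventBoxCertificate.Box`;
* §4 THE QUARTER REGION `{q ∈ VertexTori w : Im q_{ν₀} = +w_{ν₀}, Re q_{ν₁} ≤ 0}` as `2^d` sign-class root boxes (`signVec`, `quarterRootCtr ∕ Hw`,
  `quarterBoxes w ν₀ ν₁ S` for a family of schedules `S : (Fin (d+1) → Bool) → Sched d`) and **`hcov_of_schedules`** = the binder `hcov` AS A THEOREM;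
* §5 THE FIN RECTANGLE `[0,1] × [−π,π]` (`finRects F` for `F : Sched 1`) and **`hcovF_of_schedules`** = the binder `hcovF` AS A THEOREM.

With the companion anchor `CapRouteASchedules.rowsOfOneLoopFormCode16E_routeA₂_ofSchedules` the engines' job list IS the kernel's leaf list: a
certificate = (schedule data, per-leaf numbers); no coverage fact is left outside the kernel.

HONEST FRAMING.  Kernel glue ([folklore] combinatorics of grids); no schedule for the cell's `k₀`, no box count, no number is supplied or asserted
here; 0 binders instantiated; 0 certified coefficients; no box ∕ fin certificate exists.  Discharging `BetaPertH` would make Bałaban's ultraviolet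
stability unconditional — NOT the continuum limit, NOT the Clay problem.  0 `sorry`, 0 cite tags.
-/

namespace Summit.QuantumFields.BalabanUV.Beta.CoverSchedules

open Complex Set
open Summit.QuantumFields.BalabanUV.Beta.TubeMaximumModulus (VertexTori)
open Summit.QuantumFields.BalabanUV.Beta.ResolventBoxCertificate (Box)
open scoped Real

noncomputable section

variable {d : ℕ}

/-! ## §1 Real boxes and the uniform sub-grid -/

section RealBoxes

/-- the closed REAL BOX with centre `c` and half-widths `h`: `|x_μ − c_μ| ≤ h_μ` for every `μ`. [folklore] -/
def RBox (c h : Fin (d + 1) → ℝ) : Set (Fin (d + 1) → ℝ) := {x | ∀ μ, |x μ - c μ| ≤ h μ}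

/-- the CENTRE of cell `j` of the uniform sub-grid of the box `(c, h)` with `m_μ + 1` cells along coordinate `μ`:
`c_μ − h_μ + (2 j_μ + 1) h_μ ∕ (m_μ + 1)`. [folklore] -/
def subCtr (c h : Fin (d + 1) → ℝ) (m : Fin (d + 1) → ℕ) (j : (μ : Fin (d + 1)) → Fin (m μ + 1)) : Fin (d + 1) → ℝ :=
  fun μ => c μ - h μ + (2 * ((j μ : ℕ) : ℝ) + 1) * h μ / ((m μ : ℝ) + 1)

/-- the HALF-WIDTHS of the cells: `h_μ ∕ (m_μ + 1)`. [folklore] -/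
def subHw (h : Fin (d + 1) → ℝ) (m : Fin (d + 1) → ℕ) : Fin (d + 1) → ℝ := fun μ => h μ / ((m μ : ℝ) + 1)

/-- THE ONE FLOOR-LEMMA: for `u ∈ [0, 1]` and `m` there is `j ≤ m` with `|u·(m+1) − (j + ½)| ≤ ½` (`j = min(⌊u(m+1)⌋, m)`). [folklore] -/
theorem exists_fin_abs_sub_le {u : ℝ} (h0 : 0 ≤ u) (h1 : u ≤ 1) (m : ℕ) :
    ∃ j : Fin (m + 1), |u * ((m : ℝ) + 1) - (((j : ℕ) : ℝ) + 1 / 2)| ≤ 1 / 2 := by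
  set v : ℝ := u * ((m : ℝ) + 1) with hv
  have hv0 : 0 ≤ v := by positivity
  have hvm : v ≤ (m : ℝ) + 1 := by
    have : u * ((m : ℝ) + 1) ≤ 1 * ((m : ℝ) + 1) := by gcongr
    rwa [one_mul] at this
  by_cases hlt : v < (m : ℝ) + 1
  · have hfl : ⌊v⌋₊ < m + 1 := by
      rw [Nat.floor_lt hv0]; exact_mod_cast hlt
    refine ⟨⟨⌊v⌋₊, hfl⟩, ?_⟩
    have h1' := Nat.floor_le hv0
    have h2' := Nat.lt_floor_add_one v
    rw [abs_le]
    constructor <;> linarith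
  · refine ⟨⟨m, Nat.lt_succ_self m⟩, ?_⟩
    have hv' : v = (m : ℝ) + 1 := le_antisymm hvm (not_lt.mp hlt)
    rw [hv', abs_le]
    constructor <;> linarith

/-- **THE SUB-GRID COVERS THE BOX**: every point of `RBox c h` lies in some cell of the uniform sub-grid. [folklore] -/
theorem exists_mem_subBox (c h : Fin (d + 1) → ℝ) (m : Fin (d + 1) → ℕ) {x : Fin (d + 1) → ℝ} (hx : x ∈ RBox c h) :
    ∃ j : (μ : Fin (d + 1)) → Fin (m μ + 1), x ∈ RBox (subCtr c h m j) (subHw h m) := by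
  have key : ∀ μ, ∃ jμ : Fin (m μ + 1),
      |x μ - (c μ - h μ + (2 * ((jμ : ℕ) : ℝ) + 1) * h μ / ((m μ : ℝ) + 1))| ≤ h μ / ((m μ : ℝ) + 1) := by
    intro μ
    have hμ := hx μ
    have hm : (0 : ℝ) < (m μ : ℝ) + 1 := by positivity
    rcases le_or_gt (h μ) 0 with hle | hpos
    · -- `h_μ ≤ 0`: then `|x_μ − c_μ| ≤ h_μ ≤ 0` forces `h_μ = 0` and `x_μ = c_μ`
      have hh : h μ = 0 := le_antisymm hle ((abs_nonneg _).trans hμ)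
      have hxc : x μ = c μ := by
        have h0 : |x μ - c μ| ≤ 0 := hh ▸ hμ
        exact sub_eq_zero.mp (abs_nonpos_iff.mp h0)
      refine ⟨0, ?_⟩
      rw [hh, hxc]; simp
    · set u : ℝ := (x μ - (c μ - h μ)) / (2 * h μ) with hu
      have hlo := (abs_le.mp hμ).1
      have hhi := (abs_le.mp hμ).2
      have hu0 : 0 ≤ u := by rw [hu]; exact div_nonneg (by linarith) (by linarith)
      have hu1 : u ≤ 1 := by rw [hu, div_le_one (by linarith)]; linarith
      obtain ⟨jμ, hj⟩ := exists_fin_abs_sub_le hu0 hu1 (m μ)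
      refine ⟨jμ, ?_⟩
      have hne : h μ ≠ 0 := hpos.ne'
      have e : x μ - (c μ - h μ + (2 * ((jμ : ℕ) : ℝ) + 1) * h μ / ((m μ : ℝ) + 1))
          = (2 * h μ / ((m μ : ℝ) + 1)) * (u * ((m μ : ℝ) + 1) - (((jμ : ℕ) : ℝ) + 1 / 2)) := by
        rw [hu]; field_simp; ring
      rw [e, abs_mul, abs_of_pos (by positivity)]
      calc 2 * h μ / ((m μ : ℝ) + 1) * |u * ((m μ : ℝ) + 1) - (((jμ : ℕ) : ℝ) + 1 / 2)|
          ≤ 2 * h μ / ((m μ : ℝ) + 1) * (1 / 2) := by gcongr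
        _ = h μ / ((m μ : ℝ) + 1) := by ring
  choose j hj using key
  exact ⟨j, fun μ => hj μ⟩

/-- **SUB-CELLS LIE IN THE BOX**: `RBox (subCtr c h m j) (subHw h m) ⊆ RBox c h`. [folklore] -/
theorem subBox_subset (c h : Fin (d + 1) → ℝ) (m : Fin (d + 1) → ℕ) (j : (μ : Fin (d + 1)) → Fin (m μ + 1)) :
    RBox (subCtr c h m j) (subHw h m) ⊆ RBox c h := by
  intro x hx μ
  have hμ := hx μ
  simp only [subCtr, subHw] at hμ
  have hm : (0 : ℝ) < (m μ : ℝ) + 1 := by positivity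
  rcases le_or_gt 0 (h μ) with hnn | hneg
  · have hj0 : (0 : ℝ) ≤ ((j μ : ℕ) : ℝ) := Nat.cast_nonneg _
    have hj1 : ((j μ : ℕ) : ℝ) + 1 ≤ (m μ : ℝ) + 1 := by
      have := (j μ).isLt
      exact_mod_cast this
    have hlo := (abs_le.mp hμ).1
    have hhi := (abs_le.mp hμ).2
    -- the two cell faces lie inside `[c − h, c + h]`
    have f1 : 0 ≤ 2 * ((j μ : ℕ) : ℝ) * h μ / ((m μ : ℝ) + 1) := by positivity
    have f2 : (2 * ((j μ : ℕ) : ℝ) + 2) * h μ / ((m μ : ℝ) + 1) ≤ 2 * h μ := by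
      rw [div_le_iff₀ hm]
      have : (2 * ((j μ : ℕ) : ℝ) + 2) * h μ ≤ (2 * ((m μ : ℝ) + 1)) * h μ := by
        apply mul_le_mul_of_nonneg_right _ hnn; linarith
      linarith
    have e1 : (2 * ((j μ : ℕ) : ℝ) + 1) * h μ / ((m μ : ℝ) + 1) - h μ / ((m μ : ℝ) + 1)
        = 2 * ((j μ : ℕ) : ℝ) * h μ / ((m μ : ℝ) + 1) := by field_simp; ring
    have e2 : (2 * ((j μ : ℕ) : ℝ) + 1) * h μ / ((m μ : ℝ) + 1) + h μ / ((m μ : ℝ) + 1)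
        = (2 * ((j μ : ℕ) : ℝ) + 2) * h μ / ((m μ : ℝ) + 1) := by field_simp; ring
    rw [abs_le]
    constructor <;> linarith
  · -- `h_μ < 0`: the cell is empty
    exfalso
    have : h μ / ((m μ : ℝ) + 1) < 0 := div_neg_of_neg_of_pos hneg hm
    exact absurd (hμ.trans_lt this) (not_lt.mpr (abs_nonneg _))

end RealBoxes

/-! ## §2 Schedules: a leaf, or a uniform split with one sub-schedule per cell -/

section Schedules

/-- **A BOX SCHEDULE** over `ℝ^{d+1}`: `leaf` = certify the current box as one leaf; `split m child` = cut the current box into the uniform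
sub-grid with `m_μ + 1` cells along coordinate `μ` and run `child j` on cell `j`.  Every adaptive refinement tree (dyadic: all `m_μ = 1`;
anisotropic: `m_μ = 0` leaves coordinate `μ` uncut) of any depth profile is a term of this type. [folklore] -/
inductive Sched (d : ℕ) : Type
  /-- certify the current box as ONE leaf. -/
  | leaf : Sched d
  /-- cut the current box into the uniform `Π_μ (m_μ + 1)` sub-grid and schedule each cell separately. -/
  | split (m : Fin (d + 1) → ℕ) (child : ((μ : Fin (d + 1)) → Fin (m μ + 1)) → Sched d) : Sched d

/-- the UNIFORM one-level schedule: every cell of the `Π_μ (m_μ + 1)` grid is a leaf. [folklore] -/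
def Sched.uniform (m : Fin (d + 1) → ℕ) : Sched d := .split m fun _ => .leaf
/-- the DYADIC split (bisection in every coordinate, `2^{d+1}` children). [folklore] -/
def Sched.bisect (child : ((μ : Fin (d + 1)) → Fin (1 + 1)) → Sched d) : Sched d := .split (fun _ => 1) child
/-- REFINE every leaf of `s` by the schedule `t` (graft `t` at each leaf). [folklore] -/
def Sched.refine : Sched d → Sched d → Sched d
  | .leaf, t => t
  | .split m child, t => .split m fun j => (child j).refine t
/-- the uniform grid refined `n` times (depth-`n` uniform `m`-adic tree). [folklore] -/
def Sched.uniformPow (m : Fin (d + 1) → ℕ) : ℕ → Sched d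
  | 0 => .leaf
  | n + 1 => .split m fun _ => Sched.uniformPow m n

open scoped Classical in
/-- **THE LEAF LIST** of a schedule run on the root box `(c, h)`: a finite set of (centre, half-widths) pairs. [folklore] -/
def Sched.leaves : Sched d → (Fin (d + 1) → ℝ) → (Fin (d + 1) → ℝ) → Finset ((Fin (d + 1) → ℝ) × (Fin (d + 1) → ℝ))
  | .leaf, c, h => {(c, h)}
  | .split m child, c, h => Finset.univ.biUnion fun j => (child j).leaves (subCtr c h m j) (subHw h m)

/-- the leaf list of `leaf` is the root box itself. [folklore] -/
@[simp] theorem Sched.leaves_leaf (c h : Fin (d + 1) → ℝ) : (Sched.leaf : Sched d).leaves c h = {(c, h)} := rfl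

open scoped Classical in
/-- membership in the leaf list of a split: a cell `j` and a leaf of the sub-schedule on that cell. [folklore] -/
theorem Sched.mem_leaves_split {m : Fin (d + 1) → ℕ} {child : ((μ : Fin (d + 1)) → Fin (m μ + 1)) → Sched d}
    {c h : Fin (d + 1) → ℝ} {bx : (Fin (d + 1) → ℝ) × (Fin (d + 1) → ℝ)} :
    bx ∈ (Sched.split m child).leaves c h ↔ ∃ j, bx ∈ (child j).leaves (subCtr c h m j) (subHw h m) := by
  simp only [Sched.leaves, Finset.mem_biUnion, Finset.mem_univ, true_and]

/-- **COVERAGE**: the leaves of ANY schedule cover its root box. [folklore] -/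
theorem Sched.cover : ∀ (s : Sched d) (c h : Fin (d + 1) → ℝ) {x : Fin (d + 1) → ℝ}, x ∈ RBox c h →
    ∃ bx ∈ s.leaves c h, x ∈ RBox bx.1 bx.2
  | .leaf, c, h, _, hx => ⟨(c, h), by simp, hx⟩
  | .split m child, c, h, _, hx => by
    obtain ⟨j, hj⟩ := exists_mem_subBox c h m hx
    obtain ⟨bx, hbx, hxb⟩ := Sched.cover (child j) _ _ hj
    exact ⟨bx, Sched.mem_leaves_split.mpr ⟨j, hbx⟩, hxb⟩

/-- **EVERY LEAF LIES IN THE ROOT BOX** (so certifying the leaves never asks for more than the root). [folklore] -/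
theorem Sched.leaves_subset : ∀ (s : Sched d) (c h : Fin (d + 1) → ℝ) {bx : (Fin (d + 1) → ℝ) × (Fin (d + 1) → ℝ)},
    bx ∈ s.leaves c h → RBox bx.1 bx.2 ⊆ RBox c h
  | .leaf, c, h, bx, hbx => by
    have e : bx = (c, h) := by simpa using hbx
    subst e; exact le_rfl
  | .split m child, c, h, bx, hbx => by
    obtain ⟨j, hj⟩ := Sched.mem_leaves_split.mp hbx
    exact (Sched.leaves_subset (child j) _ _ hj).trans (subBox_subset c h m j)

/-- the leaf list is never empty. [folklore] -/
theorem Sched.leaves_nonempty : ∀ (s : Sched d) (c h : Fin (d + 1) → ℝ), (s.leaves c h).Nonempty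
  | .leaf, c, h => by simp
  | .split m child, c, h =>
    ⟨_, Sched.mem_leaves_split.mpr ⟨fun _ => 0, (Sched.leaves_nonempty (child _) _ _).choose_spec⟩⟩

end Schedules

/-! ## §3 Complex boxes over real leaves on a sign-class torus -/

section ComplexBoxes

/-- the complex box datum over the real leaf `bx` on the torus `Im q = σ`: centre `bx.1 + iσ`, half-widths `bx.2` — read by
`ResolventBoxCertificate.Box`. [folklore] -/
def cbox (σ : Fin (d + 1) → ℝ) (bx : (Fin (d + 1) → ℝ) × (Fin (d + 1) → ℝ)) : (Fin (d + 1) → ℂ) × (Fin (d + 1) → ℝ) :=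
  (fun μ => ((bx.1 μ : ℝ) : ℂ) + ((σ μ : ℝ) : ℂ) * I, bx.2)

/-- real part of the complex centre. [folklore] -/
@[simp] theorem cbox_fst_re (σ : Fin (d + 1) → ℝ) (bx : (Fin (d + 1) → ℝ) × (Fin (d + 1) → ℝ)) (μ : Fin (d + 1)) :
    ((cbox σ bx).1 μ).re = bx.1 μ := by simp [cbox]
/-- imaginary part of the complex centre. [folklore] -/
@[simp] theorem cbox_fst_im (σ : Fin (d + 1) → ℝ) (bx : (Fin (d + 1) → ℝ) × (Fin (d + 1) → ℝ)) (μ : Fin (d + 1)) :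
    ((cbox σ bx).1 μ).im = σ μ := by simp [cbox]
/-- the half-widths are carried over. [folklore] -/
@[simp] theorem cbox_snd (σ : Fin (d + 1) → ℝ) (bx : (Fin (d + 1) → ℝ) × (Fin (d + 1) → ℝ)) : (cbox σ bx).2 = bx.2 := rfl

/-- a point of the torus `Im q = σ` whose real part lies in the real leaf lies in the complex box over it. [folklore] -/
theorem mem_box_cbox {σ : Fin (d + 1) → ℝ} {bx : (Fin (d + 1) → ℝ) × (Fin (d + 1) → ℝ)} {q : Fin (d + 1) → ℂ}
    (him : ∀ μ, (q μ).im = σ μ) (hre : (fun μ => (q μ).re) ∈ RBox bx.1 bx.2) : q ∈ Box (cbox σ bx).1 (cbox σ bx).2 :=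
  fun μ => ⟨by rw [cbox_fst_re]; exact hre μ, by rw [cbox_fst_im]; exact him μ⟩

/-- conversely, a point of the complex box has `Im q = σ` and real part in the real leaf. [folklore] -/
theorem im_eq_of_mem_box_cbox {σ : Fin (d + 1) → ℝ} {bx : (Fin (d + 1) → ℝ) × (Fin (d + 1) → ℝ)} {q : Fin (d + 1) → ℂ}
    (hq : q ∈ Box (cbox σ bx).1 (cbox σ bx).2) : (∀ μ, (q μ).im = σ μ) ∧ (fun μ => (q μ).re) ∈ RBox bx.1 bx.2 :=
  ⟨fun μ => by rw [← cbox_fst_im σ bx μ]; exact (hq μ).2, fun μ => by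
    have h1 := (hq μ).1
    rwa [cbox_fst_re] at h1⟩

end ComplexBoxes

/-! ## §4 The quarter region of the vertex tori as sign-class root boxes; `hcov` as a theorem -/

section Quarter

/-- the imaginary-part vector of the sign class `s`: `+w_μ` where `s μ`, `−w_μ` otherwise. [folklore] -/
def signVec (w : Fin (d + 1) → ℝ) (s : Fin (d + 1) → Bool) : Fin (d + 1) → ℝ := fun μ => if s μ then w μ else -w μ

/-- the ROOT BOX of the quarter region in real parts: `[−π, 0]` along `ν₁`, `[−π, π]` elsewhere — centre. [folklore] -/
def quarterRootCtr (ν₁ : Fin (d + 1)) : Fin (d + 1) → ℝ := fun μ => if μ = ν₁ then -(π / 2) else 0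
/-- the ROOT BOX of the quarter region in real parts — half-widths. [folklore] -/
def quarterRootHw (ν₁ : Fin (d + 1)) : Fin (d + 1) → ℝ := fun μ => if μ = ν₁ then π / 2 else π
/-- the real part of a quarter-region point lies in the root box. [folklore] -/
theorem re_mem_quarterRoot {w : Fin (d + 1) → ℝ} (ν₁ : Fin (d + 1)) {q : Fin (d + 1) → ℂ} (hq : q ∈ VertexTori w)
    (h1 : (q ν₁).re ≤ 0) : (fun μ => (q μ).re) ∈ RBox (quarterRootCtr ν₁) (quarterRootHw ν₁) := by
  intro μ
  have hre := abs_le.mp (hq μ).1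
  by_cases hμ : μ = ν₁
  · subst hμ
    simp only [quarterRootCtr, quarterRootHw, if_true]
    rw [abs_le]; constructor <;> linarith
  · simp only [quarterRootCtr, quarterRootHw, hμ, if_false, sub_zero]
    exact (hq μ).1

open scoped Classical in
/-- **THE BOX LIST OF A FAMILY OF SCHEDULES ON THE QUARTER REGION**: one schedule `S s` per sign class `s` with `s ν₀ = true`, run on the root
box, its real leaves lifted to the torus `Im q = signVec w s`. [folklore] -/
def quarterBoxes (w : Fin (d + 1) → ℝ) (ν₀ ν₁ : Fin (d + 1)) (S : (Fin (d + 1) → Bool) → Sched d) :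
    Finset ((Fin (d + 1) → ℂ) × (Fin (d + 1) → ℝ)) :=
  (Finset.univ.filter fun s : Fin (d + 1) → Bool => s ν₀ = true).biUnion fun s =>
    ((S s).leaves (quarterRootCtr ν₁) (quarterRootHw ν₁)).image (cbox (signVec w s))

open scoped Classical in
/-- membership in the box list: a sign class with `s ν₀ = true` and a leaf of its schedule. [folklore] -/
theorem mem_quarterBoxes {w : Fin (d + 1) → ℝ} {ν₀ ν₁ : Fin (d + 1)} {S : (Fin (d + 1) → Bool) → Sched d}
    {bxc : (Fin (d + 1) → ℂ) × (Fin (d + 1) → ℝ)} :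
    bxc ∈ quarterBoxes w ν₀ ν₁ S ↔
      ∃ s : Fin (d + 1) → Bool, s ν₀ = true ∧
        ∃ bx ∈ (S s).leaves (quarterRootCtr ν₁) (quarterRootHw ν₁), cbox (signVec w s) bx = bxc := by
  simp only [quarterBoxes, Finset.mem_biUnion, Finset.mem_filter, Finset.mem_univ, true_and, Finset.mem_image]

/-- the sign class of a vertex-tori point READ OFF its imaginary parts reproduces them. [folklore] -/
theorem im_eq_signVec {w : Fin (d + 1) → ℝ} {q : Fin (d + 1) → ℂ} (hq : q ∈ VertexTori w) (μ : Fin (d + 1)) :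
    (q μ).im = signVec w (fun ν => decide ((q ν).im = w ν)) μ := by
  by_cases hμ : (q μ).im = w μ
  · simp [signVec, hμ]
  · have habs := (hq μ).2
    have hw : 0 ≤ w μ := habs ▸ abs_nonneg _
    rcases (abs_eq hw).mp habs with h | h
    · exact absurd h hμ
    · simp [signVec, h]

/-- **`hcov` AS A THEOREM**: for EVERY family of schedules, the box list `quarterBoxes w ν₀ ν₁ S` covers the quarter region
`{q ∈ VertexTori w : Im q_{ν₀} = w_{ν₀}, Re q_{ν₁} ≤ 0}` — literally the binder `hcov` of `ResolventBoxCertificate.hBa_of_boxes_negConjRegion`,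
`CapRouteABoxes.…_ofBoxesRealShift`, `CapRouteABoxesReflect.…_ofReflect`, `CapRouteAFins.…_ofReflect_ofFinRects` with `boxes := quarterBoxes w ν₀ ν₁ S`,
`ctr := Prod.fst`, `hw := Prod.snd`. [folklore] -/
theorem hcov_of_schedules (w : Fin (d + 1) → ℝ) (ν₀ ν₁ : Fin (d + 1)) (S : (Fin (d + 1) → Bool) → Sched d) :
    ∀ q ∈ VertexTori w, (q ν₀).im = w ν₀ → (q ν₁).re ≤ 0 →
      ∃ bx ∈ quarterBoxes w ν₀ ν₁ S, q ∈ Box (Prod.fst bx) (Prod.snd bx) := by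
  intro q hq h0 h1
  set s : Fin (d + 1) → Bool := fun ν => decide ((q ν).im = w ν) with hs
  have hs0 : s ν₀ = true := by simp [hs, h0]
  have him : ∀ μ, (q μ).im = signVec w s μ := fun μ => im_eq_signVec hq μ
  obtain ⟨bx, hbx, hxb⟩ := Sched.cover (S s) _ _ (re_mem_quarterRoot ν₁ hq h1)
  exact ⟨cbox (signVec w s) bx, mem_quarterBoxes.mpr ⟨s, hs0, bx, hbx, rfl⟩, mem_box_cbox him hxb⟩

/-- every box of the list lies on ONE sign-class torus of the vertex tori with `Im q_{ν₀} = +w_{ν₀}` and inside the quarter region's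
closure in real parts (`|Re q_μ| ≤ π`, `Re q_{ν₁} ∈ [−π, 0]`) — so a per-leaf certificate is never asked outside the region. [folklore] -/
theorem quarterBoxes_subset {w : Fin (d + 1) → ℝ} (hw : ∀ μ, 0 ≤ w μ) {ν₀ ν₁ : Fin (d + 1)}
    {S : (Fin (d + 1) → Bool) → Sched d} {bxc : (Fin (d + 1) → ℂ) × (Fin (d + 1) → ℝ)} (hb : bxc ∈ quarterBoxes w ν₀ ν₁ S)
    {q : Fin (d + 1) → ℂ} (hq : q ∈ Box bxc.1 bxc.2) : q ∈ VertexTori w ∧ (q ν₀).im = w ν₀ ∧ (q ν₁).re ≤ 0 := by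
  obtain ⟨s, hs0, bx, hbx, rfl⟩ := mem_quarterBoxes.mp hb
  obtain ⟨him, hre⟩ := im_eq_of_mem_box_cbox hq
  have hroot := Sched.leaves_subset (S s) _ _ hbx hre
  refine ⟨fun μ => ⟨?_, ?_⟩, ?_, ?_⟩
  · have h := hroot μ
    by_cases hμ : μ = ν₁
    · subst hμ
      simp only [quarterRootCtr, quarterRootHw, if_true] at h
      rw [abs_le] at h ⊢; constructor <;> linarith [Real.pi_pos]
    · simpa [quarterRootCtr, quarterRootHw, hμ] using h
  · rw [him μ]; unfold signVec; split_ifs <;> simp [abs_of_nonneg (hw μ)]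
  · rw [him ν₀]; simp [signVec, hs0]
  · have h := hroot ν₁
    simp only [quarterRootCtr, quarterRootHw, if_true] at h
    rw [abs_le] at h; linarith

end Quarter

/-! ## §5 The fin rectangle `[0,1] × [−π,π]`; `hcovF` as a theorem -/

section Fins

/-- the fin ROOT RECTANGLE `(τ, x) ∈ [0, 1] × [−π, π]` — centre `(½, 0)`. [folklore] -/
def finRootCtr : Fin (1 + 1) → ℝ := fun μ => if μ = 0 then 1 / 2 else 0
/-- the fin ROOT RECTANGLE — half-widths `(½, π)`. [folklore] -/
def finRootHw : Fin (1 + 1) → ℝ := fun μ => if μ = 0 then 1 / 2 else π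
/-- **THE RECTANGLE LIST OF A FIN SCHEDULE** `F : Sched 1` run on `[0, 1] × [−π, π]`: leaves `bx` with `τ`-centre `bx.1 0`, `τ`-half-width
`bx.2 0`, `x`-centre `bx.1 1`, `x`-half-width `bx.2 1`. [folklore] -/
def finRects (F : Sched 1) : Finset ((Fin (1 + 1) → ℝ) × (Fin (1 + 1) → ℝ)) := F.leaves finRootCtr finRootHw

/-- a fin point `(τ, x)` as a vector of `ℝ²`. [folklore] -/
def finPt (τ x : ℝ) : Fin (1 + 1) → ℝ := fun μ => if μ = 0 then τ else x

/-- the fin point lies in the root rectangle. [folklore] -/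
theorem finPt_mem_root {τ x : ℝ} (hτ : τ ∈ Icc (0 : ℝ) 1) (hx : x ∈ Icc (-π) π) : finPt τ x ∈ RBox finRootCtr finRootHw := by
  intro μ
  by_cases hμ : μ = 0
  · subst hμ
    simp only [finPt, finRootCtr, finRootHw, if_true]
    rw [abs_le]; constructor <;> linarith [hτ.1, hτ.2]
  · simp only [finPt, finRootCtr, finRootHw, hμ, if_false, sub_zero]
    exact abs_le.mpr ⟨by linarith [hx.1], hx.2⟩

/-- **`hcovF` AS A THEOREM**: for EVERY family of fin schedules `F : ι → Sched 1`, the rectangle lists `finRects (F i)` cover `[0, 1] × [−π, π]`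
— literally the binder `hcovF` of `CapRouteAFins.rowsOfOneLoopFormCode16E_routeA₂_ofBoxesRealShift_ofReflect_ofFinRects` with `rects i := finRects (F i)`,
`τc i bx := bx.1 0`, `hτ i bx := bx.2 0`, `xc i bx := bx.1 1`, `hx i bx := bx.2 1`. [folklore] -/
theorem hcovF_of_schedules {ι : Type*} (F : ι → Sched 1) :
    ∀ (i : ι), ∀ τ ∈ Icc (0 : ℝ) 1, ∀ x ∈ Icc (-π) π,
      ∃ bx ∈ finRects (F i), |τ - bx.1 0| ≤ bx.2 0 ∧ |x - bx.1 1| ≤ bx.2 1 := by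
  intro i τ hτ x hx
  obtain ⟨bx, hbx, hmem⟩ := Sched.cover (F i) _ _ (finPt_mem_root hτ hx)
  refine ⟨bx, hbx, ?_, ?_⟩
  · simpa [finPt] using hmem 0
  · simpa [finPt] using hmem 1

/-- every fin rectangle lies inside `[0, 1] × [−π, π]`: a point of a leaf has `τ ∈ [0,1]` and `x ∈ [−π, π]`. [folklore] -/
theorem finRects_subset (F : Sched 1) {bx : (Fin (1 + 1) → ℝ) × (Fin (1 + 1) → ℝ)} (hbx : bx ∈ finRects F) {τ x : ℝ}
    (hτ : |τ - bx.1 0| ≤ bx.2 0) (hx : |x - bx.1 1| ≤ bx.2 1) : τ ∈ Icc (0 : ℝ) 1 ∧ x ∈ Icc (-π) π := by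
  have hmem : finPt τ x ∈ RBox bx.1 bx.2 := by
    intro μ
    by_cases hμ : μ = 0
    · subst hμ; simpa [finPt] using hτ
    · have e : μ = 1 := Fin.eq_one_of_ne_zero μ hμ
      subst e; simpa [finPt] using hx
  have hroot := Sched.leaves_subset F _ _ hbx hmem
  have h0 := hroot 0
  have h1 := hroot 1
  simp only [finPt, finRootCtr, finRootHw, if_true, one_ne_zero, if_false, sub_zero] at h0 h1
  rw [abs_le] at h0 h1
  exact ⟨⟨by linarith, by linarith⟩, ⟨by linarith, by linarith⟩⟩

end Fins

end

end Summit.QuantumFields.BalabanUV.Beta.CoverSchedules
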